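import Literature.MathematicalPhysics.QuantumLattice.SchwartzReIm
import HarnessLib

/-!
# Continuous multilinear forms on Schwartz space: complexification and seminorm bounds

Trunk **T-AQFT** (support file for the Schwartz kernel theorem behind
`Literature.MathematicalPhysics.QuantumLattice.SchwartzTensor.existsUnique_schwingerFamilyOf`),
families `constructive-qft`, `crit-ising`.

Two elementary facts about `n`-linear forms `M` on Schwartz space `𝓢(E, 𝕜)ⁿ`:

* `multilinearComplexify`: a real `n`-linear form on `𝓢(E, ℝ)ⁿ` extends to a complex `n`-linear
  form on `𝓢(E, ℂ)ⁿ` (expand `M(re φ₁ + i im φ₁, …)` multilinearly; `2ⁿ` terms indexed by the set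
  of slots carrying a real part), agreeing with `M` on complexified real functions
  (`multilinearComplexify_ofRealTest`) and continuous if `M` is (`continuous_multilinearComplexify`);
* `MultilinearMap.exists_bound_of_continuous_schwartz`: a (jointly) continuous multilinear form is
  bounded by a product of finitely many Schwartz seminorms, `|M(f)| ≤ C ∏ᵢ q(fᵢ)` — the multilinear
  analogue of Mathlib's `Seminorm.bound_of_continuous`; packaged as the predicate
  `MultilinearMap.IsBoundedBySeminorms M s C`.

## Mathlib

Used: `MultilinearMap` (`map_update_add`, `map_update_smul`, `map_smul_univ`, `map_coord_zero`),
`schwartz_withSeminorms` (`WithSeminorms.mem_nhds_iff`), `Finset.sum_powerset_insert`. Mathlib has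
`ContinuousMultilinearMap` only over normed spaces for the operator-norm theory; the Schwartz space
is a Fréchet space, so bounds are phrased with finite suprema of `schwartzSeminormFamily`. Searched
and absent at the pin: complexification of multilinear maps (`MultilinearMap.complexify`: no hits),
bounds of continuous multilinear maps on `WithSeminorms` spaces.
-/

open scoped SchwartzMap
open Complex

noncomputable section

namespace Literature.MathematicalPhysics.QuantumLattice

variable {E : Type*} [NormedAddCommGroup E] [NormedSpace ℝ E] {n : ℕ}

/-! ### Selecting real or imaginary parts slotwise -/

/-- For a set `t` of slots, take real parts in the slots of `t` and imaginary parts elsewhere: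
`(reImSel t φ)ᵢ = re φᵢ` if `i ∈ t`, `im φᵢ` otherwise. [folklore] -/
def reImSel (t : Finset (Fin n)) (φ : Fin n → 𝓢(E, ℂ)) : Fin n → 𝓢(E, ℝ) :=
  fun i => if i ∈ t then reTest (φ i) else imTest (φ i)

/-- Unfolding of `reImSel`. [folklore] -/
theorem reImSel_apply (t : Finset (Fin n)) (φ : Fin n → 𝓢(E, ℂ)) (i : Fin n) :
    reImSel t φ i = if i ∈ t then reTest (φ i) else imTest (φ i) := rfl

/-- `reImSel` commutes with updating a slot. [folklore] -/
theorem reImSel_update [DecidableEq (Fin n)] (t : Finset (Fin n)) (φ : Fin n → 𝓢(E, ℂ))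
    (j : Fin n) (y : 𝓢(E, ℂ)) :
    reImSel t (Function.update φ j y) =
      Function.update (reImSel t φ) j (if j ∈ t then reTest y else imTest y) := by
  funext i
  by_cases h : i = j
  · subst h; simp [reImSel]
  · simp [reImSel, Function.update_of_ne h]

/-- On complexified real functions, `reImSel univ` returns the functions and any other selection
has a zero slot. [folklore] -/
theorem reImSel_ofRealTest_univ (f : Fin n → 𝓢(E, ℝ)) :
    reImSel Finset.univ (fun i => ofRealTest (f i)) = f := by
  funext i
  simp only [reImSel, Finset.mem_univ, if_true]
  ext x; simp

/-- On complexified real functions a selection missing a slot has a zero entry there. [folklore] -/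
theorem reImSel_ofRealTest_of_not_mem {t : Finset (Fin n)} {i : Fin n} (hi : i ∉ t)
    (f : Fin n → 𝓢(E, ℝ)) : reImSel t (fun i => ofRealTest (f i)) i = 0 := by
  simp only [reImSel, hi, if_false]
  ext x; simp

/-- Continuity of `reImSel t` (real and imaginary parts are continuous linear). [folklore] -/
theorem continuous_reImSel (t : Finset (Fin n)) :
    Continuous (reImSel (E := E) t) := by
  refine continuous_pi fun i => ?_
  by_cases h : i ∈ t
  · simp only [reImSel, h, if_true]
    exact (reTest (X := E)).continuous.comp (continuous_apply i)
  · simp only [reImSel, h, if_false]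
    exact (imTest (X := E)).continuous.comp (continuous_apply i)

/-! ### Complexification of a real multilinear form -/

/-- **Complexification of a real multilinear form on Schwartz space**: for a real `n`-linear form
`M` on `𝓢(E, ℝ)ⁿ`, the complex `n`-linear form on `𝓢(E, ℂ)ⁿ`
`M_ℂ(φ₁, …, φₙ) = ∑_{t ⊆ [n]} i^{n - |t|} M(ψᵗ)`, `ψᵗᵢ = re φᵢ` (`i ∈ t`), `im φᵢ` (`i ∉ t`),
i.e. the multilinear expansion of `M(re φ₁ + i im φ₁, …)`; consistent with the expansion of
tensor products `eq_sum_tensorFin_reIm`. [folklore] -/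
def multilinearComplexify (M : MultilinearMap ℝ (fun _ : Fin n => 𝓢(E, ℝ)) ℝ) :
    MultilinearMap ℂ (fun _ : Fin n => 𝓢(E, ℂ)) ℂ where
  toFun φ := ∑ t : Finset (Fin n), I ^ (n - t.card) * (M (reImSel t φ) : ℂ)
  map_update_add' φ j x y := by
    rw [← Finset.sum_add_distrib]
    refine Finset.sum_congr rfl fun t _ => ?_
    rw [← mul_add]
    congr 1
    rw [reImSel_update, reImSel_update, reImSel_update]
    split_ifs
    · rw [map_add, M.map_update_add]; push_cast; rfl
    · rw [map_add, M.map_update_add]; push_cast; rfl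
  map_update_smul' φ j c x := by
    -- pair the subsets not containing `j` with those containing it
    have hpow : (Finset.univ : Finset (Finset (Fin n))) = (insert j (Finset.univ.erase j)).powerset := by
      rw [Finset.insert_erase (Finset.mem_univ j), Finset.powerset_univ]
    have hj : j ∉ (Finset.univ : Finset (Fin n)).erase j := Finset.notMem_erase j _
    rw [hpow, Finset.sum_powerset_insert hj, Finset.sum_powerset_insert hj, smul_add,
      Finset.smul_sum, Finset.smul_sum, ← Finset.sum_add_distrib, ← Finset.sum_add_distrib]
    refine Finset.sum_congr rfl fun t ht => ?_
    have hjt : j ∉ t := fun h => hj (Finset.mem_powerset.1 ht h)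
    have hcard : (insert j t).card = t.card + 1 := Finset.card_insert_of_notMem hjt
    have hjins : j ∈ insert j t := Finset.mem_insert_self j t
    -- the two updated families share the same base
    have hbase : reImSel (insert j t) φ = fun i => if i = j then reTest (φ j) else reImSel t φ i := by
      funext i
      by_cases h : i = j
      · subst h; simp [reImSel]
      · simp [reImSel, Finset.mem_insert, h]
    rw [reImSel_update, reImSel_update, reImSel_update, reImSel_update]
    simp only [hjt, if_false, hjins, if_true]
    have hupd : ∀ z : 𝓢(E, ℝ), Function.update (reImSel (insert j t) φ) j z =
        Function.update (reImSel t φ) j z := by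
      intro z
      rw [hbase]
      funext i
      by_cases h : i = j
      · subst h; simp
      · simp [h]
    rw [hupd, hupd]
    -- real and imaginary parts of `c • x`
    have hre : reTest (c • x) = c.re • reTest x - c.im • imTest x := by
      ext y; simp [Complex.mul_re]
    have him : imTest (c • x) = c.re • imTest x + c.im • reTest x := by
      ext y; simp [Complex.mul_im]
    rw [hre, him]
    simp only [M.map_update_smul, MultilinearMap.map_update_sub,
      MultilinearMap.map_update_add, smul_eq_mul]
    -- powers of `I`
    have hn : n - t.card = (n - (insert j t).card) + 1 := by
      rw [hcard]
      have : t.card + 1 ≤ n := by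
        have := Finset.card_le_univ (insert j t)
        rw [hcard, Fintype.card_fin] at this
        exact this
      omega
    rw [hn, pow_succ]
    set A : ℂ := (M (Function.update (reImSel t φ) j (reTest x)) : ℂ)
    set B : ℂ := (M (Function.update (reImSel t φ) j (imTest x)) : ℂ)
    set P : ℂ := I ^ (n - (insert j t).card)
    push_cast
    have hc : c = (c.re : ℂ) + (c.im : ℂ) * I := (Complex.re_add_im c).symm
    conv_rhs => rw [hc]
    ring_nf
    rw [Complex.I_sq]
    ring

/-- Unfolding of `multilinearComplexify`. [folklore] -/
@[simp]
theorem multilinearComplexify_apply (M : MultilinearMap ℝ (fun _ : Fin n => 𝓢(E, ℝ)) ℝ)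
    (φ : Fin n → 𝓢(E, ℂ)) :
    multilinearComplexify M φ = ∑ t : Finset (Fin n), I ^ (n - t.card) * (M (reImSel t φ) : ℂ) :=
  rfl

/-- The complexification extends `M`: on complexified real test functions it is `M`. [folklore] -/
theorem multilinearComplexify_ofRealTest (M : MultilinearMap ℝ (fun _ : Fin n => 𝓢(E, ℝ)) ℝ)
    (f : Fin n → 𝓢(E, ℝ)) :
    multilinearComplexify M (fun i => ofRealTest (f i)) = (M f : ℂ) := by
  rw [multilinearComplexify_apply, Finset.sum_eq_single Finset.univ]
  · simp [reImSel_ofRealTest_univ]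
  · intro t _ ht
    obtain ⟨i, hi⟩ : ∃ i, i ∉ t := by
      by_contra h
      push Not at h
      exact ht (Finset.eq_univ_of_forall h)
    rw [M.map_coord_zero i (reImSel_ofRealTest_of_not_mem hi f)]
    simp
  · intro h; exact absurd (Finset.mem_univ _) h

/-- The complexification of a continuous multilinear form is continuous. [folklore] -/
theorem continuous_multilinearComplexify {M : MultilinearMap ℝ (fun _ : Fin n => 𝓢(E, ℝ)) ℝ}
    (hM : Continuous M) : Continuous (multilinearComplexify M) := by
  change Continuous fun φ => ∑ t : Finset (Fin n), I ^ (n - t.card) * (M (reImSel t φ) : ℂ)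
  refine continuous_finsetSum _ fun t _ => continuous_const.mul ?_
  exact Complex.continuous_ofReal.comp (hM.comp (continuous_reImSel t))

/-! ### Product seminorm bounds for continuous multilinear forms -/

/-- **A continuous multilinear form on Schwartz space is bounded by a product of seminorms**:
there are a finite family of Schwartz seminorms with supremum `q` and a constant `C` such that
`|M(f₁, …, fₙ)| ≤ C ∏ᵢ q(fᵢ)`. (Continuity at `0` gives a seminorm ball on which `|M| < 1`;
rescale each argument. If some `q(fᵢ) = 0` then `M(f) = 0`.) The multilinear analogue of
Mathlib's `Seminorm.bound_of_continuous`. [folklore] -/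
theorem _root_.MultilinearMap.exists_bound_of_continuous_schwartz {𝕜 : Type*} [RCLike 𝕜]
    (M : MultilinearMap 𝕜 (fun _ : Fin n => 𝓢(E, 𝕜)) 𝕜) (hM : Continuous M) :
    ∃ (s : Finset (ℕ × ℕ)) (C : ℝ), 0 < C ∧ ∀ f : Fin n → 𝓢(E, 𝕜),
      ‖M f‖ ≤ C * ∏ i, (s.sup (schwartzSeminormFamily 𝕜 E 𝕜)) (f i) := by
  -- the degenerate case `n = 0`: `M` is a constant
  rcases isEmpty_or_nonempty (Fin n) with hn | hn
  · refine ⟨∅, ‖M fun _ => 0‖ + 1, by positivity, fun f => ?_⟩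
    have hf : f = fun _ => 0 := funext fun i => (IsEmpty.false i).elim
    rw [hf, Finset.univ_eq_empty, Finset.prod_empty, mul_one]
    linarith
  haveI := hn
  -- a seminorm ball at `0` on which `‖M‖ < 1`
  have h0 : M 0 = 0 := M.map_zero
  have hpre : (fun f => M f) ⁻¹' Metric.ball 0 1 ∈ nhds (0 : Fin n → 𝓢(E, 𝕜)) := by
    refine hM.continuousAt.preimage_mem_nhds ?_
    rw [h0]; exact Metric.ball_mem_nhds _ one_pos
  rw [nhds_pi, Filter.mem_pi'] at hpre
  obtain ⟨I0, U, hU, hsub⟩ := hpre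
  have hU' : ∀ i, ∃ (s : Finset (ℕ × ℕ)) (r : ℝ), 0 < r ∧
      (s.sup (schwartzSeminormFamily 𝕜 E 𝕜)).ball 0 r ⊆ U i := fun i =>
    ((schwartz_withSeminorms 𝕜 E 𝕜).mem_nhds_iff 0 (U i)).1 (by simpa using hU i)
  choose s r hr hball using hU'
  set S : Finset (ℕ × ℕ) := Finset.univ.biUnion s with hS
  set q : Seminorm 𝕜 𝓢(E, 𝕜) := S.sup (schwartzSeminormFamily 𝕜 E 𝕜) with hq
  have hqi : ∀ i, s i ⊆ S := fun i => Finset.subset_biUnion_of_mem s (Finset.mem_univ i)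
  obtain ⟨ε, hε, hεr⟩ : ∃ ε : ℝ, 0 < ε ∧ ∀ i, ε ≤ r i :=
    ⟨Finset.univ.inf' Finset.univ_nonempty r, (Finset.lt_inf'_iff _).2 fun i _ => hr i,
      fun i => Finset.inf'_le _ (Finset.mem_univ i)⟩
  -- key: `q (g i) < ε` for all `i` implies `‖M g‖ < 1`
  have hkey : ∀ g : Fin n → 𝓢(E, 𝕜), (∀ i, q (g i) < ε) → ‖M g‖ < 1 := by
    intro g hg
    have hmem : g ∈ Set.pi (I0 : Set (Fin n)) U := by
      intro i _
      refine hball i ?_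
      rw [Seminorm.mem_ball_zero]
      have hle : (s i).sup (schwartzSeminormFamily 𝕜 E 𝕜) ≤ q := Finset.sup_mono (hqi i)
      exact (Seminorm.le_def.1 hle (g i)).trans_lt ((hg i).trans_le (hεr i))
    have := hsub hmem
    simpa using this
  refine ⟨S, (2 / ε) ^ n, by positivity, fun f => ?_⟩
  set a : Fin n → ℝ := fun i => q (f i) with ha
  have ha0 : ∀ i, 0 ≤ a i := fun i => apply_nonneg _ _
  -- first rescaling: bring every nonzero seminorm to `ε / 2`
  set c : Fin n → ℝ := fun i => if a i = 0 then 1 else (ε / 2) / a i with hc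
  have hc0 : ∀ i, 0 < c i := fun i => by
    simp only [hc]
    split_ifs with h
    · exact one_pos
    · exact div_pos (by positivity) (lt_of_le_of_ne (ha0 i) (Ne.symm h))
  set g : Fin n → 𝓢(E, 𝕜) := fun i => ((c i : ℝ) : 𝕜) • f i with hg
  have hqg : ∀ i, q (g i) < ε := by
    intro i
    simp only [hg]
    rw [map_smul_eq_mul, RCLike.norm_ofReal, abs_of_pos (hc0 i)]
    simp only [hc]
    split_ifs with h
    · change 1 * a i < ε
      rw [h, mul_zero]; exact hε
    · change (ε / 2) / a i * a i < ε
      rw [div_mul_cancel₀ _ h]; linarith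
  have hMg : M g = (∏ i, ((c i : ℝ) : 𝕜)) • M f := by
    simp only [hg]
    exact M.map_smul_univ _ _
  have hprod_pos : 0 < ∏ i, c i := Finset.prod_pos fun i _ => hc0 i
  have hnorm_prod : ‖∏ i, ((c i : ℝ) : 𝕜)‖ = ∏ i, c i := by
    rw [norm_prod]
    exact Finset.prod_congr rfl fun i _ => by rw [RCLike.norm_ofReal, abs_of_pos (hc0 i)]
  by_cases hz : ∃ j, a j = 0
  · -- some seminorm vanishes: `M f = 0`
    obtain ⟨j, hj⟩ := hz
    have hMg0 : M g = 0 := by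
      by_contra hne
      have hpos : 0 < ‖M g‖ := norm_pos_iff.2 hne
      -- rescale slot `j` by a large real `t`
      have ht : ∀ t : ℝ, 0 < t → t * ‖M g‖ < 1 := by
        intro t ht
        have hq' : ∀ i, q (Function.update g j (((t : ℝ) : 𝕜) • g j) i) < ε := by
          intro i
          by_cases h : i = j
          · subst h
            rw [Function.update_self, map_smul_eq_mul, RCLike.norm_ofReal, abs_of_pos ht]
            have : q (g i) = 0 := by
              simp only [hg]
              rw [map_smul_eq_mul, RCLike.norm_ofReal, abs_of_pos (hc0 i)]
              change c i * a i = 0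
              rw [hj, mul_zero]
            rw [this, mul_zero]; exact hε
          · rw [Function.update_of_ne h]; exact hqg i
        have h := hkey _ hq'
        rw [M.map_update_smul, Function.update_eq_self, norm_smul, RCLike.norm_ofReal,
          abs_of_pos ht] at h
        exact h
      have h2 := ht (2 / ‖M g‖) (by positivity)
      rw [div_mul_cancel₀ _ hpos.ne'] at h2
      norm_num at h2
    have hMf : M f = 0 := by
      rw [hMg, smul_eq_zero] at hMg0
      rcases hMg0 with h | h
      · rw [← norm_eq_zero, hnorm_prod] at h
        exact absurd h hprod_pos.ne'
      · exact h
    rw [hMf, norm_zero]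
    exact mul_nonneg (by positivity) (Finset.prod_nonneg fun i _ => ha0 i)
  · -- all seminorms nonzero
    push Not at hz
    have hci : ∀ i, c i = (ε / 2) / a i := fun i => by simp only [hc, hz i, if_false]
    have h1 : ‖M g‖ < 1 := hkey g hqg
    rw [hMg, norm_smul, hnorm_prod] at h1
    have hprod_eq : ∏ i, c i = (ε / 2) ^ n / ∏ i, a i := by
      rw [Finset.prod_congr rfl fun i _ => hci i, Finset.prod_div_distrib, Finset.prod_const,
        Finset.card_univ, Fintype.card_fin]
    have hapos : 0 < ∏ i, a i := Finset.prod_pos fun i _ => lt_of_le_of_ne (ha0 i) (Ne.symm (hz i))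
    rw [hprod_eq, div_mul_eq_mul_div, div_lt_one hapos] at h1
    -- `(ε/2)^n ‖M f‖ < ∏ a i`
    have hε2 : (0 : ℝ) < (ε / 2) ^ n := by positivity
    calc ‖M f‖ = ((ε / 2) ^ n)⁻¹ * ((ε / 2) ^ n * ‖M f‖) := by field_simp
      _ ≤ ((ε / 2) ^ n)⁻¹ * ∏ i, a i := by gcongr
      _ = (2 / ε) ^ n * ∏ i, a i := by rw [← inv_pow, inv_div]

/-- `M` is **bounded by the finite family `s` of Schwartz seminorms with constant `C`**:
`|M(f₁, …, fₙ)| ≤ C ∏ᵢ (sup_s p)(fᵢ)`. [folklore] -/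
def _root_.MultilinearMap.IsBoundedBySeminorms {𝕜 : Type*} [RCLike 𝕜]
    (M : MultilinearMap 𝕜 (fun _ : Fin n => 𝓢(E, 𝕜)) 𝕜) (s : Finset (ℕ × ℕ)) (C : ℝ) : Prop :=
  0 ≤ C ∧ ∀ f : Fin n → 𝓢(E, 𝕜), ‖M f‖ ≤ C * ∏ i, (s.sup (schwartzSeminormFamily 𝕜 E 𝕜)) (f i)

/-- A continuous multilinear form is bounded by some finite family of seminorms. [folklore] -/
theorem _root_.MultilinearMap.exists_isBoundedBySeminorms {𝕜 : Type*} [RCLike 𝕜]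
    (M : MultilinearMap 𝕜 (fun _ : Fin n => 𝓢(E, 𝕜)) 𝕜) (hM : Continuous M) :
    ∃ (s : Finset (ℕ × ℕ)) (C : ℝ), M.IsBoundedBySeminorms s C := by
  obtain ⟨s, C, hC, h⟩ := M.exists_bound_of_continuous_schwartz hM
  exact ⟨s, C, hC.le, h⟩

/-- Enlarging the family of seminorms preserves boundedness. [folklore] -/
theorem _root_.MultilinearMap.IsBoundedBySeminorms.mono {𝕜 : Type*} [RCLike 𝕜]
    {M : MultilinearMap 𝕜 (fun _ : Fin n => 𝓢(E, 𝕜)) 𝕜} {s s' : Finset (ℕ × ℕ)} {C : ℝ}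
    (h : M.IsBoundedBySeminorms s C) (hs : s ⊆ s') : M.IsBoundedBySeminorms s' C := by
  refine ⟨h.1, fun f => (h.2 f).trans (mul_le_mul_of_nonneg_left ?_ h.1)⟩
  exact Finset.prod_le_prod (fun i _ => apply_nonneg _ _) fun i _ =>
    Seminorm.le_def.1 (Finset.sup_mono hs) (f i)

end Literature.MathematicalPhysics.QuantumLattice
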